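import Summits.QuantumFields.BalabanUV.T4Continuum.Support.ShellMeasureCommutatorGradient

/-!
# `T4Continuum.ShellMeasureCommutatorGradientLocal` — WALL §2 (a) item (P4), THE ∇-PART (row S65 f3, file 4): THE
# BOUND WITH LOCALISED HYPOTHESES — `|B| ≤ a` and `|∇^η_{U₀}B| ≤ G` are read ONLY on two explicit finite site sets
# around the bond, as the multi-grid (98) packaging needs (row S65 holder leaf-02-g8's request, journal l.15673), and
# the constant improves to `144(d − 1)` (cell `pub-balaban`, sub-cell `t4`, NE7c (node U5b); unit
# `b2b-balaban-t4-ne7c-formalise-leaf-05` gen 7; ADDITIVE — imports file 3 `ShellMeasureCommutatorGradient` ONLY;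
# [folklore]; 2 DATA defs (the two site sets), 0 sorry)

HONEST FRAMING.  Finite four-torus programme, rung (B)+1 only — NOT infinite volume, NOT a mass gap, NOT the Clay
problem, NOT summit progress; (B), `BetaPertHyp`, (B^μ) are not consumed.  NE7c (`T4IndicatorShell.ShellWeightBound`)
is NOT PRINTED and NOT PROVED; «NE7c ⇐ the named binders» (WALL `t4/b2b-balaban-t4-ne7c-p1/WALL-NE7c-P1.md` §2).
ELEMENTARY covariant lattice calculus ([folklore]) over the b08 lineage's KERNEL modules (`B8Eq151V2Divergence`: the
EXACT identities (1.50) `eq150`, (1.52) `eq152`, `pdiv_brk0`, the transport identity `covDeriv_eq_neg_conjR_covDerivFwd`);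
[Balaban1985Variational] (B11) p. 284 (39) and p. 292 (91)–(96) are LOCATORS for the SHAPE only — the paper is under
adjudication (ABSOLUTE RULE), nothing printed is asserted or cited as a fact; no `def … : Prop` is minted.  HONEST
DEPENDENCY (cell): continuum YM on T⁴ ⇐ BetaPertH ∧ nine spine estimates (0/9 proved); BetaPertH ⇐ (D1) ∧ (D4) ∧
CAP+tail; G-an2-4 gates asym, D1 and NE2/3/4.

WHY THIS FILE (leaf-02-g8, l.15673).  File 3 `ShellMeasureCommutatorGradient.norm_sum_dcub_bump_le` states the bound
`176(d−1)·|w|·‖τ‖·a·G·‖X‖` under b08's GLOBAL hypothesis shapes `∀ x μ, ‖B x μ‖ ≤ a`, `∀ x κ τ, ‖(D^η_{U₀,κ}B_τ)(x)‖ ≤ G`.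
At the live levels the weights vary across `Ω_j`; the multi-grid constant is scale-free exactly because each bond's
gradient is bounded by the field's size NEAR that bond — and the localised statement is NOT a corollary of the global
one (a field truncated to a neighbourhood violates a global ∇-bound at the truncation boundary by `η⁻¹|B|`, the very
factor being avoided).  So the chain is RE-PROVED here reading the hypotheses only on
* `baseSites y := {y} ∪ {y − e_ν : ν}` — the base points of the star plaquettes, where (1.50)'s `(D_μB_ν)(x)`,
  `(D_νB_μ)(x)` and (1.52)'s transported `(D*_νB)(y) = −R(…)(D_νB)(y − e_ν)` are read (hypothesis `hG`);
* `nbhdSites y κ := {y, y + e_κ} ∪ ⋃_ν {y + e_ν, y − e_ν, y − e_ν + e_κ}` — the sites carrying the bonds of the `2(d − 1)`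
  star plaquettes and the forward points of the `η(D_μB_ν)(x) = R(…)B_ν(x + e_μ) − B_ν(x)` rewritings (hypothesis `hB`).
The background stays `U1`-valued everywhere (it is the background).  ROUTE (better constant than file 3's detour through
`V₂ − (Σᵢxᵢ)²`): `D^{η*}{…} = D^{η*}(2[B_μ, B_ν]) + D^{η*}({…} − 2[B_μ, B_ν])`; the first by the EXACT `pdiv_brk0` + (1.52)
with local bounds (`16(d−1)aG`), the second CRUDELY — `|{…} − 2[B_μ, B_ν]| ≤ 16ηaG` per plaquette from the EXACT (1.50)
(the five η-carrying commutators: «we use these factors to cancel η⁻¹») and `|D^{η*}_νF(x)| ≤ η⁻¹(|F(x − e_ν)| + |F(x)|)`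
(`32(d−1)aG`) — so `|D^{η*}{…}| ≤ 48(d−1)aG` and the theorem's constant is `48(d−1) + 96(d−1) = 144(d−1)`.

WHAT THIS FILE PROVES (kernel):
* §1 the two site sets with membership lemmas; §2 pointwise bounds — `norm_plaqCovDeriv_le_at` (`2G`), `norm_dbrk_le_at`
  (`24ah`), `norm_brk_sub_brk0_le_at` (`16ηaG`), `norm_covDeriv_adR_le_at` (`8aG`, b08's (1.52) argument with point
  hypotheses), `norm_covDeriv_le_crude_at`; §3 **`norm_pdiv_brk_le_local`** (`48(d−1)aG`) and **THE THEOREM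
  `norm_sum_dcub_bump_le_local`**: `0 < η`, `U1`-valued `U₀`, `hB` on `nbhdSites y κ`, `hG` on `baseSites y`, τ tracial,
  `plaqStar y κ ⊆ Pl ⊆ increasing` ⟹ `‖Σ_{p∈Pl} dcub w τ η U₀ B (bump y κ X) p‖ ≤ 144(d − 1)·‖w‖·‖τ‖·a·G·‖X‖`; derivative
  form `hasDerivAt_sum_cub_bump_norm_le_local`.
NOT HERE: the finite-volume packaging ∕ `δ_bT = locGrad T B b` (S65 f5, leaf-02-g8), `ord₃` (S65 f4), HD-dressing (S66), [dict].
-/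

noncomputable section

open scoped BigOperators
open NormedSpace Finset

namespace Summit.QuantumFields.BalabanUV.T4Continuum.ShellMeasureCommutatorGradientLocal

open Literature.MathematicalPhysics.QuantumFieldTheory.Balaban1983to89
open B7Prop1Explicit (e U1)
open B7Eq78Linearization (conjR conjR_apply conjR_add conjR_sub conjR_smul)
open B8Ineq132 (covDeriv covDerivFwd norm_conjR_le norm_conjR)
open B8Eq143PlaqExpansion (pdiv norm_sub_sums_le)
open B8Eq146AExpansion (X1 X2 X3 X4 lin adR plaqCovDeriv norm_adR_le conjR_neg plaqCovDeriv_eq_covDerivFwd)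
open B8Eq151V2Divergence (brk brk0 brk0_apply eq150 eq152 pdiv_brk0 norm_covDeriv_eq norm_adR_le_of_le
  covDeriv_eq_neg_conjR_covDerivFwd norm_two_mul_le adR_smul_left_real eta_smul_covDeriv eta_smul_covDerivFwd)
open ShellMeasureCommutatorVariation ShellMeasureCommutatorByParts ShellMeasureCommutatorGradient

export B7Prop1Explicit (Site)

variable {d : ℕ}

/-! ## §1 The two finite site sets around the bond `⟨y, y + e_κ⟩` -/

section Sites

/-- The BASE POINTS of the star plaquettes (and one more): `{y} ∪ {y − e_ν : ν}` — where the covariant derivatives are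
read. [folklore] -/
def baseSites (y : Site d) : Finset (Site d) := insert y (univ.image fun ν : Fin d => y - e ν)

/-- The sites carrying the bonds of the `2(d − 1)` star plaquettes and the forward points of the `η(D_μB_ν)(x)`
rewritings: `{y, y + e_κ} ∪ ⋃_ν {y + e_ν, y − e_ν, y − e_ν + e_κ}`. [folklore] -/
def nbhdSites (y : Site d) (κ : Fin d) : Finset (Site d) :=
  insert y (insert (y + e κ) (univ.biUnion fun ν : Fin d => ({y + e ν, y - e ν, y - e ν + e κ} : Finset (Site d))))

/-- `y ∈ baseSites y`. [folklore] -/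
theorem mem_baseSites_self (y : Site d) : y ∈ baseSites y := by simp [baseSites]
/-- `y − e_ν ∈ baseSites y`. [folklore] -/
theorem mem_baseSites_sub (y : Site d) (ν : Fin d) : y - e ν ∈ baseSites y := by
  simp only [baseSites, mem_insert, mem_image, mem_univ, true_and]
  exact Or.inr ⟨ν, rfl⟩

/-- `y ∈ nbhdSites y κ`. [folklore] -/
theorem mem_nbhdSites_self (y : Site d) (κ : Fin d) : y ∈ nbhdSites y κ := by simp [nbhdSites]
/-- `y + e_ν ∈ nbhdSites y κ`. [folklore] -/
theorem mem_nbhdSites_add (y : Site d) (κ ν : Fin d) : y + e ν ∈ nbhdSites y κ := by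
  simp only [nbhdSites, mem_insert, mem_biUnion, mem_univ, true_and, mem_singleton]
  exact Or.inr (Or.inr ⟨ν, Or.inl rfl⟩)

/-- `y − e_ν ∈ nbhdSites y κ`. [folklore] -/
theorem mem_nbhdSites_sub (y : Site d) (κ ν : Fin d) : y - e ν ∈ nbhdSites y κ := by
  simp only [nbhdSites, mem_insert, mem_biUnion, mem_univ, true_and, mem_singleton]
  exact Or.inr (Or.inr ⟨ν, Or.inr (Or.inl rfl)⟩)

/-- `y − e_ν + e_κ ∈ nbhdSites y κ`. [folklore] -/
theorem mem_nbhdSites_sub_add (y : Site d) (κ ν : Fin d) : y - e ν + e κ ∈ nbhdSites y κ := by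
  simp only [nbhdSites, mem_insert, mem_biUnion, mem_univ, true_and, mem_singleton]
  exact Or.inr (Or.inr ⟨ν, Or.inr (Or.inr rfl)⟩)

end Sites

/-! ## §2 Pointwise bounds with point hypotheses -/
section Pointwise

variable {𝔸 : Type*} [NormedRing 𝔸] [NormOneClass 𝔸] [NormedAlgebra ℂ 𝔸]

omit [NormOneClass 𝔸] in
/-- `|(D^η_{U₀}B)(p_{μν}(x))| ≤ 2G` from the two derivatives AT `x`. [folklore] -/
theorem norm_plaqCovDeriv_le_at {η : ℝ} {U₀ : Site d → Fin d → 𝔸ˣ} {B : Site d → Fin d → 𝔸} {G : ℝ} {μ ν : Fin d}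
    {x : Site d} (hP : ‖covDerivFwd η U₀ μ (fun z => B z ν) x‖ ≤ G) (hQ : ‖covDerivFwd η U₀ ν (fun z => B z μ) x‖ ≤ G) :
    ‖plaqCovDeriv η U₀ B μ ν x‖ ≤ 2 * G := by
  rw [plaqCovDeriv_eq_covDerivFwd]
  calc _ ≤ ‖covDerivFwd η U₀ μ (fun y => B y ν) x‖ + ‖covDerivFwd η U₀ ν (fun y => B y μ) x‖ := norm_sub_le _ _
    _ ≤ G + G := add_le_add hP hQ
    _ = 2 * G := by ring

omit [NormedAlgebra ℂ 𝔸] in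
/-- `|δ{…}(B)[H](p)| ≤ 24·a·h` from the four bond values of `B` and of `H` on `∂p` (`U1`-valued transports). [folklore] -/
theorem norm_dbrk_le_at {U₀ : Site d → Fin d → 𝔸ˣ} (h₀ : ∀ y κ, U₀ y κ ∈ U1 𝔸) {B H : Site d → Fin d → 𝔸} {a h : ℝ}
    {μ ν : Fin d} {x : Site d} (b1 : ‖B x μ‖ ≤ a) (b2 : ‖B (x + e μ) ν‖ ≤ a) (b3 : ‖B (x + e ν) μ‖ ≤ a)
    (b4 : ‖B x ν‖ ≤ a) (c1 : ‖H x μ‖ ≤ h) (c2 : ‖H (x + e μ) ν‖ ≤ h) (c3 : ‖H (x + e ν) μ‖ ≤ h) (c4 : ‖H x ν‖ ≤ h) :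
    ‖dbrk U₀ B H μ ν x‖ ≤ 24 * a * h := by
  have pair : ∀ {P Q P' Q' : 𝔸}, ‖P‖ ≤ h → ‖Q‖ ≤ a → ‖P'‖ ≤ a → ‖Q'‖ ≤ h →
      ‖adR P Q + adR P' Q'‖ ≤ 4 * a * h := by
    intro P Q P' Q' hP hQ hP' hQ'
    calc ‖adR P Q + adR P' Q'‖ ≤ ‖adR P Q‖ + ‖adR P' Q'‖ := norm_add_le _ _
      _ ≤ 2 * h * a + 2 * a * h := add_le_add (norm_adR_le_of_le hP hQ) (norm_adR_le_of_le hP' hQ')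
      _ = 4 * a * h := by ring
  have e2 : ‖X2 U₀ B μ ν x‖ ≤ a := (norm_conjR_le (h₀ x μ) _).trans b2
  have e2' : ‖X2 U₀ H μ ν x‖ ≤ h := (norm_conjR_le (h₀ x μ) _).trans c2
  have e3 : ‖X3 U₀ B μ ν x‖ ≤ a := (norm_conjR_le (h₀ x ν) _).trans ((norm_neg _).trans_le b3)
  have e3' : ‖X3 U₀ H μ ν x‖ ≤ h := (norm_conjR_le (h₀ x ν) _).trans ((norm_neg _).trans_le c3)
  have e4 : ‖X4 B ν x‖ ≤ a := (norm_neg _).trans_le b4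
  have e4' : ‖X4 H ν x‖ ≤ h := (norm_neg _).trans_le c4
  unfold dbrk
  refine (norm_add₆_le _ _ _ _ _ _).trans ?_
  have t1 := pair c1 e2 b1 e2'
  have t2 := pair c1 e3 b1 e3'
  have t3 := pair c1 e4 b1 e4'
  have t4 := pair e2' e3 e2 e3'
  have t5 := pair e2' e4 e2 e4'
  have t6 := pair e3' e4 e3 e4'
  unfold X1 at t1 t2 t3 ⊢
  linarith

/-- THE FIVE η-CARRYING COMMUTATORS OF (1.50): `|{…}(p_{μν}(x)) − 2[B_μ(x), B_ν(x)]| ≤ 16η·a·G` from `|B_μ(x)|, |B_ν(x)|,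
|B_ν(x + e_μ)| ≤ a` and `|(D_μB_ν)(x)|, |(D_νB_μ)(x)| ≤ G` (`4 + 4 + 2 + 2 + 4`; the `η²`-term through
`|η(D_μB_ν)(x)| ≤ 2a`). [folklore] -/
theorem norm_brk_sub_brk0_le_at {η : ℝ} (hη : 0 < η) {U₀ : Site d → Fin d → 𝔸ˣ} (h₀ : ∀ y κ, U₀ y κ ∈ U1 𝔸)
    {B : Site d → Fin d → 𝔸} {a G : ℝ} {μ ν : Fin d} {x : Site d} (ha : ‖B x μ‖ ≤ a) (hb : ‖B x ν‖ ≤ a)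
    (hc : ‖B (x + e μ) ν‖ ≤ a) (hP : ‖covDerivFwd η U₀ μ (fun z => B z ν) x‖ ≤ G)
    (hQ : ‖covDerivFwd η U₀ ν (fun z => B z μ) x‖ ≤ G) :
    ‖brk U₀ B μ ν x - brk0 B μ ν x‖ ≤ 16 * η * a * G := by
  rw [eq150 hη.ne', brk0_apply]
  set P' := covDerivFwd η U₀ μ (fun y => B y ν) x with hP'def
  set Q' := covDerivFwd η U₀ ν (fun y => B y μ) x with hQ'def
  have hηP : ‖η • P'‖ ≤ 2 * a := by
    rw [hP'def, eta_smul_covDerivFwd hη.ne']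
    calc _ ≤ ‖conjR (U₀ x μ) (B (x + e μ) ν)‖ + ‖B x ν‖ := norm_sub_le _ _
      _ ≤ a + a := add_le_add ((norm_conjR_le (h₀ x μ) _).trans hc) hb
      _ = 2 * a := by ring
  have hsn : ∀ Z : 𝔸, ‖η • Z‖ = η * ‖Z‖ := fun Z => by rw [norm_smul, Real.norm_of_nonneg hη.le]
  have t2 : ‖2 * (η • adR (B x μ) P')‖ ≤ 2 * (η * (2 * a * G)) := by
    refine (norm_two_mul_le _).trans (mul_le_mul_of_nonneg_left ?_ zero_le_two)
    rw [hsn]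
    exact mul_le_mul_of_nonneg_left (norm_adR_le_of_le ha hP) hη.le
  have t3 : ‖2 * (η • adR Q' (B x ν))‖ ≤ 2 * (η * (2 * G * a)) := by
    refine (norm_two_mul_le _).trans (mul_le_mul_of_nonneg_left ?_ zero_le_two)
    rw [hsn]
    exact mul_le_mul_of_nonneg_left (norm_adR_le_of_le hQ hb) hη.le
  have t4 : ‖η • adR (B x μ) Q'‖ ≤ η * (2 * a * G) := by
    rw [hsn]
    exact mul_le_mul_of_nonneg_left (norm_adR_le_of_le ha hQ) hη.le
  have t5 : ‖η • adR P' (B x ν)‖ ≤ η * (2 * G * a) := by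
    rw [hsn]
    exact mul_le_mul_of_nonneg_left (norm_adR_le_of_le hP hb) hη.le
  have t6 : ‖η ^ 2 • adR P' Q'‖ ≤ η * (2 * (2 * a) * G) := by
    rw [sq, ← smul_smul, ← adR_smul_left_real η P' Q', hsn]
    exact mul_le_mul_of_nonneg_left (norm_adR_le_of_le hηP hQ) hη.le
  have heq : 2 * adR (B x μ) (B x ν) + 2 * (η • adR (B x μ) P') + 2 * (η • adR Q' (B x ν)) - η • adR (B x μ) Q'
        - η • adR P' (B x ν) - η ^ 2 • adR P' Q' - 2 * adR (B x μ) (B x ν) =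
      2 * (η • adR (B x μ) P') + 2 * (η • adR Q' (B x ν)) + (-(η • adR (B x μ) Q')) + (-(η • adR P' (B x ν)))
        + (-(η ^ 2 • adR P' Q')) + 0 := by abel
  rw [heq]
  refine (norm_add₆_le _ _ _ _ _ _).trans ?_
  rw [norm_neg, norm_neg, norm_neg, norm_zero]
  nlinarith [t2, t3, t4, t5, t6]

/-- b08's (1.52) ARGUMENT WITH POINT HYPOTHESES: `|(D*_ν[B_κ, B_ν])(y)| ≤ 8·a·G` from `|(D_νB_κ)(y − e_ν)|,
|(D_νB_ν)(y − e_ν)| ≤ G` (the transport identity) and `|B_κ(y)|, |B_ν(y)|, |B_κ(y − e_ν)| ≤ a`. [folklore] -/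
theorem norm_covDeriv_adR_le_at {η : ℝ} (hη : 0 < η) {U₀ : Site d → Fin d → 𝔸ˣ} (h₀ : ∀ y κ, U₀ y κ ∈ U1 𝔸)
    {B : Site d → Fin d → 𝔸} {a G : ℝ} {κ ν : Fin d} {y : Site d}
    (hF : ‖covDerivFwd η U₀ ν (fun z => B z κ) (y - e ν)‖ ≤ G)
    (hH : ‖covDerivFwd η U₀ ν (fun z => B z ν) (y - e ν)‖ ≤ G)
    (hyκ : ‖B y κ‖ ≤ a) (hyν : ‖B y ν‖ ≤ a) (hzκ : ‖B (y - e ν) κ‖ ≤ a) :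
    ‖covDeriv η U₀ ν (fun z => adR (B z κ) (B z ν)) y‖ ≤ 8 * a * G := by
  rw [eq152 hη.ne' U₀ (fun z => B z κ) (fun z => B z ν) ν y, ← adR_smul_left_real]
  have hDF : ‖covDeriv η U₀ ν (fun z => B z κ) y‖ ≤ G := by
    rw [norm_covDeriv_eq (h₀ _ _)]
    exact hF
  have hDH : ‖covDeriv η U₀ ν (fun z => B z ν) y‖ ≤ G := by
    rw [norm_covDeriv_eq (h₀ _ _)]
    exact hH
  have hηDF : ‖η • covDeriv η U₀ ν (fun z => B z κ) y‖ ≤ 2 * a := by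
    rw [eta_smul_covDeriv hη.ne']
    calc _ ≤ ‖conjR (U₀ (y - e ν) ν)⁻¹ (B (y - e ν) κ)‖ + ‖B y κ‖ := norm_sub_le _ _
      _ ≤ a + a := add_le_add ((norm_conjR_le ((U1 𝔸).inv_mem (h₀ _ _)) _).trans hzκ) hyκ
      _ = 2 * a := by ring
  calc _ ≤ ‖adR (η • covDeriv η U₀ ν (fun z => B z κ) y) (covDeriv η U₀ ν (fun z => B z ν) y)‖ +
        ‖adR (covDeriv η U₀ ν (fun z => B z κ) y) (B y ν)‖ + ‖adR (B y κ) (covDeriv η U₀ ν (fun z => B z ν) y)‖ :=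
        norm_add₃_le
    _ ≤ 2 * (2 * a) * G + 2 * G * a + 2 * a * G :=
        add_le_add (add_le_add (norm_adR_le_of_le hηDF hDH) (norm_adR_le_of_le hDF hyν))
          (norm_adR_le_of_le hyκ hDH)
    _ = 8 * a * G := by ring

/-- THE CRUDE adjoint-derivative bound with TWO point hypotheses: `|(D^{η*}_νF)(x)| ≤ η⁻¹(M₁ + M₂)` for
`|F(x − e_ν)| ≤ M₁`, `|F(x)| ≤ M₂`. [folklore] -/
theorem norm_covDeriv_le_crude_at {η : ℝ} (hη : 0 < η) {U₀ : Site d → Fin d → 𝔸ˣ} (h₀ : ∀ y κ, U₀ y κ ∈ U1 𝔸)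
    {F : Site d → 𝔸} {M₁ M₂ : ℝ} {ν : Fin d} {x : Site d} (h1 : ‖F (x - e ν)‖ ≤ M₁) (h2 : ‖F x‖ ≤ M₂) :
    ‖covDeriv η U₀ ν F x‖ ≤ η⁻¹ * (M₁ + M₂) := by
  rw [covDeriv, norm_smul, Real.norm_of_nonneg (inv_nonneg.2 hη.le)]
  refine mul_le_mul_of_nonneg_left ?_ (inv_nonneg.2 hη.le)
  calc ‖conjR (U₀ (x - e ν) ν)⁻¹ (F (x - e ν)) - F x‖
      ≤ ‖conjR (U₀ (x - e ν) ν)⁻¹ (F (x - e ν))‖ + ‖F x‖ := norm_sub_le _ _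
    _ ≤ M₁ + M₂ := add_le_add ((norm_conjR_le ((U1 𝔸).inv_mem (h₀ _ _)) _).trans h1) h2

end Pointwise

/-! ## §3 The localised divergence bound and THE THEOREM -/
section Local

variable {𝔸 : Type*} [NormedRing 𝔸] [NormOneClass 𝔸] [NormedAlgebra ℂ 𝔸]

/-- THE SITES OF A STAR PLAQUETTE: its base point lies in `baseSites y`, and the three sites carrying its four bonds lie
in `nbhdSites y κ`. [folklore] -/
theorem plaqStar_sites {y : Site d} {κ : Fin d} {p : Fin d × Fin d × Site d} (hp : p ∈ plaqStar y κ) :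
    p.2.2 ∈ baseSites y ∧ p.2.2 ∈ nbhdSites y κ ∧ p.2.2 + e p.1 ∈ nbhdSites y κ ∧
      p.2.2 + e p.2.1 ∈ nbhdSites y κ := by
  simp only [plaqStar, mem_union, mem_image, mem_Ioi, mem_Iio] at hp
  rcases hp with (⟨ν, -, rfl⟩ | ⟨ν, -, rfl⟩) | (⟨μ, -, rfl⟩ | ⟨μ, -, rfl⟩)
  · exact ⟨mem_baseSites_self y, mem_nbhdSites_self y κ, mem_nbhdSites_add y κ κ, mem_nbhdSites_add y κ ν⟩
  · refine ⟨mem_baseSites_sub y ν, mem_nbhdSites_sub y κ ν, mem_nbhdSites_sub_add y κ ν, ?_⟩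
    dsimp only
    rw [sub_add_cancel]
    exact mem_nbhdSites_self y κ
  · refine ⟨mem_baseSites_sub y μ, mem_nbhdSites_sub y κ μ, ?_, mem_nbhdSites_sub_add y κ μ⟩
    dsimp only
    rw [sub_add_cancel]
    exact mem_nbhdSites_self y κ
  · exact ⟨mem_baseSites_self y, mem_nbhdSites_self y κ, mem_nbhdSites_add y κ μ, mem_nbhdSites_add y κ κ⟩

/-- **THE ADJOINT DIVERGENCE OF THE BRACKET, LOCALISED: `|(D^{η*}_{U₀}{…}_B)_κ(y)| ≤ 48(d − 1)·a·G`** with `|B| ≤ a` read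
on `nbhdSites y κ` and `|∇^η_{U₀}B| ≤ G` read on `baseSites y` only — `16(d−1)` from `2[B_μ, B_ν]` by (1.52), `32(d−1)`
from the five η-carrying commutators of (1.50) bounded crudely. [folklore] -/
theorem norm_pdiv_brk_le_local {η : ℝ} (hη : 0 < η) {U₀ : Site d → Fin d → 𝔸ˣ} (h₀ : ∀ y κ, U₀ y κ ∈ U1 𝔸)
    {B : Site d → Fin d → 𝔸} {a G : ℝ} {y : Site d} {κ : Fin d}
    (hB : ∀ (x : Site d) (μ : Fin d), x ∈ nbhdSites y κ → ‖B x μ‖ ≤ a)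
    (hG : ∀ (x : Site d) (κ' τ : Fin d), x ∈ baseSites y → ‖covDerivFwd η U₀ κ' (fun z => B z τ) x‖ ≤ G) :
    ‖pdiv η U₀ (brk U₀ B) κ y‖ ≤ 48 * ((d : ℝ) - 1) * a * G := by
  have hy := mem_nbhdSites_self y κ
  -- (i) the main term `2[B_μ, B_ν]` by (1.52): `16(d−1)aG`
  have h0 : ‖pdiv η U₀ (brk0 B) κ y‖ ≤ 16 * ((d : ℝ) - 1) * a * G := by
    rw [pdiv_brk0, norm_neg]
    refine (norm_two_mul_le _).trans ?_
    have hs : ‖∑ ν ∈ univ.erase κ, covDeriv η U₀ ν (fun z => adR (B z κ) (B z ν)) y‖ ≤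
        ((d : ℝ) - 1) * (8 * a * G) := by
      refine (norm_sum_le_of_le _ fun ν _ => norm_covDeriv_adR_le_at hη h₀
        (hG _ _ _ (mem_baseSites_sub y ν)) (hG _ _ _ (mem_baseSites_sub y ν)) (hB _ _ hy) (hB _ _ hy)
        (hB _ _ (mem_nbhdSites_sub y κ ν))).trans ?_
      rw [sum_const, nsmul_eq_mul, card_erase_of_mem (mem_univ κ), card_univ, Fintype.card_fin,
        Nat.cast_pred (Fin.pos κ)]
    linarith
  -- (ii) the η-carrying rest `{…} − 2[B_μ, B_ν]`, crudely: each adjoint derivative `≤ η⁻¹(16ηaG + 16ηaG) = 32aG`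
  have hval : ∀ (μ ν : Fin d) (x : Site d), x ∈ baseSites y → ‖B x μ‖ ≤ a → ‖B x ν‖ ≤ a →
      ‖B (x + e μ) ν‖ ≤ a → ‖brk U₀ B μ ν x - brk0 B μ ν x‖ ≤ 16 * η * a * G :=
    fun μ ν x hx h1 h2 h3 => norm_brk_sub_brk0_le_at hη h₀ h1 h2 h3 (hG _ _ _ hx) (hG _ _ _ hx)
  have h32 : η⁻¹ * (16 * η * a * G + 16 * η * a * G) = 32 * a * G := by
    field_simp
    ring
  have hIio : ∀ ν ∈ Iio κ, ‖covDeriv η U₀ ν (fun z => brk U₀ B ν κ z - brk0 B ν κ z) y‖ ≤ 32 * a * G := by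
    intro ν _
    have h1 := hval ν κ (y - e ν) (mem_baseSites_sub y ν) (hB _ _ (mem_nbhdSites_sub y κ ν))
      (hB _ _ (mem_nbhdSites_sub y κ ν)) (by rw [sub_add_cancel]; exact hB _ _ hy)
    have h2 := hval ν κ y (mem_baseSites_self y) (hB _ _ hy) (hB _ _ hy) (hB _ _ (mem_nbhdSites_add y κ ν))
    exact (norm_covDeriv_le_crude_at hη h₀ h1 h2).trans h32.le
  have hIoi : ∀ ν ∈ Ioi κ, ‖covDeriv η U₀ ν (fun z => brk U₀ B κ ν z - brk0 B κ ν z) y‖ ≤ 32 * a * G := by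
    intro ν _
    have h1 := hval κ ν (y - e ν) (mem_baseSites_sub y ν) (hB _ _ (mem_nbhdSites_sub y κ ν))
      (hB _ _ (mem_nbhdSites_sub y κ ν)) (hB _ _ (mem_nbhdSites_sub_add y κ ν))
    have h2 := hval κ ν y (mem_baseSites_self y) (hB _ _ hy) (hB _ _ hy) (hB _ _ (mem_nbhdSites_add y κ κ))
    exact (norm_covDeriv_le_crude_at hη h₀ h1 h2).trans h32.le
  have hrest : ‖pdiv η U₀ (fun μ ν x => brk U₀ B μ ν x - brk0 B μ ν x) κ y‖ ≤ ((d : ℝ) - 1) * (32 * a * G) := by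
    unfold pdiv
    exact norm_sub_sums_le hIio hIoi
  -- (iii) assemble
  have hsplit : pdiv η U₀ (brk U₀ B) κ y =
      pdiv η U₀ (fun μ ν x => brk U₀ B μ ν x - brk0 B μ ν x) κ y + pdiv η U₀ (brk0 B) κ y := by
    rw [pdiv_sub, sub_add_cancel]
  rw [hsplit]
  calc _ ≤ ‖pdiv η U₀ (fun μ ν x => brk U₀ B μ ν x - brk0 B μ ν x) κ y‖ + ‖pdiv η U₀ (brk0 B) κ y‖ :=
        norm_add_le _ _
    _ ≤ ((d : ℝ) - 1) * (32 * a * G) + 16 * ((d : ℝ) - 1) * a * G := add_le_add hrest h0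
    _ = 48 * ((d : ℝ) - 1) * a * G := by ring

/-- **THE ∇-PART WITH LOCALISED HYPOTHESES.**  On b08's `ℤ^d` lattice of spacing `η > 0` with a `U1`-valued
background, let `|B(x, μ)| ≤ a` for `x ∈ nbhdSites y κ` and `|(D^η_{U₀,κ′}B_τ)(x)| ≤ G` for `x ∈ baseSites y` ONLY, `τ`
tracial, `Pl` a finite set of increasing plaquettes containing the star of `b = ⟨y, y + e_κ⟩`.  Then
`‖Σ_{p∈Pl} dcub w τ η U₀ B (bump y κ X) p‖ ≤ 144(d − 1)·‖w‖·‖τ‖·a·G·‖X‖` — `48(d−1)` from the localised adjoint divergence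
of the bracket after the pointwise summation by parts, `96(d−1)` from the `2(d−1)` star plaquettes; no `η⁻¹a²`, no
volume, no `#Pl`. [folklore] -/
theorem norm_sum_dcub_bump_le_local {η : ℝ} (hη : 0 < η) {U₀ : Site d → Fin d → 𝔸ˣ} (h₀ : ∀ y κ, U₀ y κ ∈ U1 𝔸)
    {B : Site d → Fin d → 𝔸} {a G : ℝ} {y : Site d} {κ : Fin d}
    (hB : ∀ (x : Site d) (μ : Fin d), x ∈ nbhdSites y κ → ‖B x μ‖ ≤ a)
    (hG : ∀ (x : Site d) (κ' τ : Fin d), x ∈ baseSites y → ‖covDerivFwd η U₀ κ' (fun z => B z τ) x‖ ≤ G)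
    (w : ℂ) {tr : 𝔸 →L[ℂ] ℂ} (htr : ∀ P Q : 𝔸, tr (P * Q) = tr (Q * P))
    {Pl : Finset (Fin d × Fin d × Site d)} (hst : plaqStar y κ ⊆ Pl) (hincr : ∀ p ∈ Pl, p.1 < p.2.1) (X : 𝔸) :
    ‖∑ p ∈ Pl, dcub w tr η U₀ B (bump y κ X) p.1 p.2.1 p.2.2‖ ≤
      144 * ((d : ℝ) - 1) * ‖w‖ * ‖tr‖ * a * G * ‖X‖ := by
  have hy := mem_nbhdSites_self y κ
  have ha : 0 ≤ a := (norm_nonneg _).trans (hB y κ hy)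
  have hGnn : 0 ≤ G := (norm_nonneg _).trans (hG y κ κ (mem_baseSites_self y))
  have hd : 0 ≤ (d : ℝ) - 1 := by
    have : 1 ≤ d := Nat.succ_le_of_lt (Fin.pos κ)
    have : (1 : ℝ) ≤ d := by exact_mod_cast this
    linarith
  -- (i) restrict to the star; (ii) split `dcub` into its two terms
  rw [sum_eq_sum_plaqStar hst hincr fun p _ hlt hps => dcub_bump_eq_zero w tr η U₀ B hlt hps X]
  have hsplit : ∀ p : Fin d × Fin d × Site d, dcub w tr η U₀ B (bump y κ X) p.1 p.2.1 p.2.2 =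
      w * tr (plaqCovDeriv η U₀ (bump y κ X) p.1 p.2.1 p.2.2 * brk U₀ B p.1 p.2.1 p.2.2)
        + w * tr (plaqCovDeriv η U₀ B p.1 p.2.1 p.2.2 * dbrk U₀ B (bump y κ X) p.1 p.2.1 p.2.2) := by
    intro p
    rw [dcub, map_add, mul_add]
  rw [sum_congr rfl fun p _ => hsplit p, sum_add_distrib, ← mul_sum,
    sum_plaqStar_tr_plaqCovDeriv_bump η htr U₀ (brk U₀ B) y κ X]
  -- (iii) the summation-by-parts term: `48(d−1)`
  have t1 : ‖w * tr (X * pdiv η U₀ (brk U₀ B) κ y)‖ ≤ ‖w‖ * ‖tr‖ * (48 * ((d : ℝ) - 1) * a * G) * ‖X‖ := by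
    rw [norm_mul]
    have h := (tr.le_opNorm _).trans (mul_le_mul_of_nonneg_left
      ((norm_mul_le _ _).trans (mul_le_mul_of_nonneg_left (norm_pdiv_brk_le_local hη h₀ hB hG) (norm_nonneg X)))
      (norm_nonneg tr))
    calc ‖w‖ * ‖tr (X * pdiv η U₀ (brk U₀ B) κ y)‖ ≤ ‖w‖ * (‖tr‖ * (‖X‖ * (48 * ((d : ℝ) - 1) * a * G))) :=
          mul_le_mul_of_nonneg_left h (norm_nonneg w)
      _ = ‖w‖ * ‖tr‖ * (48 * ((d : ℝ) - 1) * a * G) * ‖X‖ := by ring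
  -- (iv) the star term: `2(d−1)` plaquettes, each `≤ |w|‖τ‖·2G·24a‖X‖`, hypotheses read at the plaquette's sites
  have hX : ∀ y' κ', ‖bump y κ X y' κ'‖ ≤ ‖X‖ := fun y' κ' => norm_bump_le y y' κ κ' X
  have t2' : ∀ p ∈ plaqStar y κ,
      ‖w * tr (plaqCovDeriv η U₀ B p.1 p.2.1 p.2.2 * dbrk U₀ B (bump y κ X) p.1 p.2.1 p.2.2)‖
        ≤ ‖w‖ * ‖tr‖ * (2 * G) * (24 * a * ‖X‖) := by
    intro p hp
    obtain ⟨hb, hx, hxμ, hxν⟩ := plaqStar_sites hp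
    rw [norm_mul]
    have hP : ‖plaqCovDeriv η U₀ B p.1 p.2.1 p.2.2‖ ≤ 2 * G :=
      norm_plaqCovDeriv_le_at (hG _ _ _ hb) (hG _ _ _ hb)
    have hD : ‖dbrk U₀ B (bump y κ X) p.1 p.2.1 p.2.2‖ ≤ 24 * a * ‖X‖ :=
      norm_dbrk_le_at h₀ (hB _ _ hx) (hB _ _ hxμ) (hB _ _ hxν) (hB _ _ hx) (hX _ _) (hX _ _) (hX _ _) (hX _ _)
    have h : ‖tr (plaqCovDeriv η U₀ B p.1 p.2.1 p.2.2 * dbrk U₀ B (bump y κ X) p.1 p.2.1 p.2.2)‖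
        ≤ ‖tr‖ * (2 * G * (24 * a * ‖X‖)) :=
      (tr.le_opNorm _).trans (mul_le_mul_of_nonneg_left ((norm_mul_le _ _).trans
        (mul_le_mul hP hD (norm_nonneg _) (by positivity))) (norm_nonneg tr))
    calc _ ≤ ‖w‖ * (‖tr‖ * (2 * G * (24 * a * ‖X‖))) := mul_le_mul_of_nonneg_left h (norm_nonneg w)
      _ = _ := by ring
  have t2 : ‖∑ p ∈ plaqStar y κ, w * tr (plaqCovDeriv η U₀ B p.1 p.2.1 p.2.2
      * dbrk U₀ B (bump y κ X) p.1 p.2.1 p.2.2)‖ ≤ 96 * ((d : ℝ) - 1) * ‖w‖ * ‖tr‖ * a * G * ‖X‖ := by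
    refine (norm_sum_le_of_le _ t2').trans ?_
    rw [sum_const, nsmul_eq_mul]
    have hc := card_plaqStar_le y κ
    have hnn : 0 ≤ ‖w‖ * ‖tr‖ * (2 * G) * (24 * a * ‖X‖) := by positivity
    nlinarith
  calc _ ≤ ‖w * tr (X * pdiv η U₀ (brk U₀ B) κ y)‖ + ‖∑ p ∈ plaqStar y κ, w * tr (plaqCovDeriv η U₀ B p.1 p.2.1 p.2.2
        * dbrk U₀ B (bump y κ X) p.1 p.2.1 p.2.2)‖ := norm_add_le _ _
    _ ≤ ‖w‖ * ‖tr‖ * (48 * ((d : ℝ) - 1) * a * G) * ‖X‖ + 96 * ((d : ℝ) - 1) * ‖w‖ * ‖tr‖ * a * G * ‖X‖ :=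
        add_le_add t1 t2
    _ = 144 * ((d : ℝ) - 1) * ‖w‖ * ‖tr‖ * a * G * ‖X‖ := by ring

/-- **THE SAME AS A DERIVATIVE STATEMENT** with localised hypotheses: `t ↦ Σ_{p∈Pl} cub(B + t·ι_bX)(p)` has a
derivative `δ` at `0` with `‖δ‖ ≤ 144(d − 1)·|w|·‖τ‖·a·G·‖X‖`. [folklore] -/
theorem hasDerivAt_sum_cub_bump_norm_le_local {η : ℝ} (hη : 0 < η) {U₀ : Site d → Fin d → 𝔸ˣ}
    (h₀ : ∀ y κ, U₀ y κ ∈ U1 𝔸) {B : Site d → Fin d → 𝔸} {a G : ℝ} {y : Site d} {κ : Fin d}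
    (hB : ∀ (x : Site d) (μ : Fin d), x ∈ nbhdSites y κ → ‖B x μ‖ ≤ a)
    (hG : ∀ (x : Site d) (κ' τ : Fin d), x ∈ baseSites y → ‖covDerivFwd η U₀ κ' (fun z => B z τ) x‖ ≤ G)
    (w : ℂ) {tr : 𝔸 →L[ℂ] ℂ} (htr : ∀ P Q : 𝔸, tr (P * Q) = tr (Q * P))
    {Pl : Finset (Fin d × Fin d × Site d)} (hst : plaqStar y κ ⊆ Pl) (hincr : ∀ p ∈ Pl, p.1 < p.2.1) (X : 𝔸) :
    ∃ δ : ℂ, HasDerivAt (fun t : ℂ => ∑ p ∈ Pl, cub w tr η U₀ (B + t • bump y κ X) p.1 p.2.1 p.2.2) δ 0 ∧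
      ‖δ‖ ≤ 144 * ((d : ℝ) - 1) * ‖w‖ * ‖tr‖ * a * G * ‖X‖ :=
  ⟨_, hasDerivAt_sum_cub Pl w tr η U₀ B (bump y κ X), norm_sum_dcub_bump_le_local hη h₀ hB hG w htr hst hincr X⟩

end Local

end Summit.QuantumFields.BalabanUV.T4Continuum.ShellMeasureCommutatorGradientLocal

end
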